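import Mathlib.FieldTheory.PrimitiveElement
import Mathlib.FieldTheory.SeparableClosure
import HarnessLib

/-!
# The primitive element theorem, ambient form (crux `Valuative.LuAlphaPTorsor`, line `pfaff-line-log-final-forms`)

Stub D4 `stub_separablePrimitiveElement` of the line `pfaff-line-log-final-forms` (item
`stmt-ResolutionOfSingularities-0641`, skeleton reshape v6.5). The assembly of the dense-Abhyankar
range (Knaf–Kuhlmann, *Every place admits local uniformization in a finite extension of the
function field*, Adv. Math. 221 (2009) 428–453, Thm. 1.5, first case) climbs a separating
transcendence basis `t` of `K/F₀` and then needs the finite separable top extension `K/F₀(t)` to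
be SIMPLE, generated by one separable element, so that the Hensel-root form of Lemma 3.7 applies
once. This file proves exactly that, in the ambient form the assembly consumes:

* `stub_separablePrimitiveElement` — for a field `F` with an algebra map into a field `Ω` and
  finitely many elements `g ⊆ Ω`, each separable over `F`, there is `w ∈ Ω` separable over `F`
  with `F(w) = F(g)` as intermediate fields of `Ω/F`.

Proof: `E := F(g)` is a finite separable extension of `F`
(`IntermediateField.isSeparable_adjoin_iff_isSeparable`, `IntermediateField.finiteDimensional_adjoin`),
so Mathlib's primitive element theorem `Field.exists_primitive_element` gives `α : E` with
`F⟮α⟯ = ⊤` inside `E`; this is transported to `Ω` along `IntermediateField.lift`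
(`lift_adjoin_simple`, `lift_top`), and `w := ↑α` is separable over `F` because `E/F` is
separable (`IsSeparable.map` along the inclusion `E → Ω`). Nothing beyond Mathlib is used.
-/

-- the summit namespace `Summit.ResolutionOfSingularities.ResolutionOfSingularities.…` repeats a component
set_option linter.dupNamespace false

namespace Summit.ResolutionOfSingularities.ResolutionOfSingularities.Theorems.PfaffLine

/-- A finite separable subextension `E ⊆ Ω` of `F` is simple, with an ambient generator:
`E = F(α)` for some `α ∈ Ω` (necessarily `α ∈ E`) separable over `F` (primitive element theorem
`Field.exists_primitive_element`, transported along `IntermediateField.lift`). [folklore] -/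
theorem exists_isSeparable_and_adjoin_simple_eq_of_isSeparable {F Ω : Type*} [Field F] [Field Ω]
    [Algebra F Ω] (E : IntermediateField F Ω) [FiniteDimensional F E] [Algebra.IsSeparable F E] :
    ∃ w : Ω, IsSeparable F w ∧ IntermediateField.adjoin F {w} = E := by
  obtain ⟨α, hα⟩ := Field.exists_primitive_element F E
  refine ⟨α, ?_, ?_⟩
  · exact (Algebra.IsSeparable.isSeparable F α).map E.val Subtype.val_injective
  · have h := congrArg IntermediateField.lift hα
    rwa [IntermediateField.lift_adjoin_simple, IntermediateField.lift_top] at h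

/-- Stub D4 (reshape v6.5): **primitive element theorem, ambient form**: finitely many elements
`g ⊆ Ω` separable over `F` generate a simple extension `F(g) = F(w)` of `F` inside `Ω`, with
`w ∈ Ω` separable over `F` (`Field.exists_primitive_element` for the finite separable extension
`F(g)|F`). [folklore] -/
theorem stub_separablePrimitiveElement :
    ∀ (F Ω : Type) [Field F] [Field Ω] [Algebra F Ω] (g : Finset Ω), (∀ x ∈ g, IsSeparable F x) → ∃ w : Ω, IsSeparable F w ∧ IntermediateField.adjoin F {w} = IntermediateField.adjoin F (g : Set Ω) := by
  intro F Ω _ _ _ g hg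
  haveI : Algebra.IsSeparable F (IntermediateField.adjoin F (g : Set Ω)) :=
    (IntermediateField.isSeparable_adjoin_iff_isSeparable F Ω).mpr fun x hx => hg x hx
  haveI : FiniteDimensional F (IntermediateField.adjoin F (g : Set Ω)) :=
    IntermediateField.finiteDimensional_adjoin fun x hx => (hg x hx).isIntegral
  exact exists_isSeparable_and_adjoin_simple_eq_of_isSeparable _

end Summit.ResolutionOfSingularities.ResolutionOfSingularities.Theorems.PfaffLine
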